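import Literature.AnabelianGeometry.SemiGraphs.FreeProPTwoConjugacyDetection
import Literature.AnabelianGeometry.SemiGraphs.ThetaRayLevelKernel
import Literature.AnabelianGeometry.SemiGraphs.ThetaRayGraphFreeProP
import Literature.AnabelianGeometry.SemiGraphs.TemperedPiBranchStabilizerImage
import HarnessLib

/-!
# Two local frames of one element at one vertex of the canonical tower of `𝒢_θ` differ by the branch group
# (typed-form audit of [SemiAnbd] Thm 3.7 (iv) clause 2 at `𝒢_θ`, row «B9·ANCHOR-FREE-PAIR», brick K-B1)

Mochizuki, *Semi-graphs of anabelioids*, Publ. RIMS **42** (2006), §3, Theorem 3.7 (iii)/(iv) pp. 40–41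
and Remark 2.2.1 p. 24 (branch stabilisers are conjugates of the branch subgroups)
[cite: MochizukiSemiAnbd2006, Thm 3.7(iv) p.41].

PROOF-ONLY file (abc-iut cell, layer L3, seat abc-iut-L3-d4 gen 5; row «B9·ANCHOR-FREE-PAIR@𝒢_θ»;
frontier / erratum-grade label — typed-form audit of the cell's ∀-countable typing of Thm 3.7 (iv) at
abc-iut-L3-d1's countermodel `𝒢_θ(p,n)`, OUTSIDE the [IUTchIII] Cor. 3.12 cone; 0 definitions, no named fact).
Desk memo `HOME/staging/L3/L3-d4/g5/B9-ANCHOR-FREE-PAIR.md`, step (S1): the ONE-VERTEX step of the two-level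
argument «deep fixed points of `c^{p^m}` project onto fixed points of `c`».

abc-iut-L3-t11's local branch-stabiliser dictionary (`PointSeq.exists_gal_conj_brHom_of_edgeMap_eq`,
`exists_conj_brHom_pair_of_edgeMap_eq`) writes the level-`N` component of an element `g` fixing an edge at
the tree vertex of a point sequence `P` over `w` as `σ_N^{f · b_*(k) · f⁻¹}` — a FRAME `(f, b, k)` of `g` at
`P`.  This file proves that at DEEP levels of the canonical tower of `𝒢_θ(p,n) = thetaRayFreeProP p n` two
frames of the same level-`N` element differ by an element of the branch group, up to any prescribed open
subgroup `V` of the vertex group `F̂₂⁽ᵖ⁾`: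

* `thetaRayFreeProP_frame_shift` — for every compact `Λ ⊆ ℤ_p ∖ {0}` and open subgroup `V` there is a level
  `N₀` such that for all `N ≥ N₀`, every vertex `w`, every point sequence `P` over `w`, all branches
  `b₁, b₂` at `w` and all `f₁, f₂ ∈ F̂₂⁽ᵖ⁾`, `k₁ ∈ ℤ_p`, `k₂ ∈ Λ`:
  `σ_N^{f₁ b₁*(k₁) f₁⁻¹} = σ_N^{f₂ b₂*(k₂) f₂⁻¹} ⇒ f₂⁻¹ f₁ ∈ Π_{b₂} · V`.

Proof: the equality of the two `σ_N` puts `(f₁ b₁*(k₁) f₁⁻¹)⁻¹ (f₂ b₂*(k₂) f₂⁻¹)` in the stabiliser of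
`P.pt N` (`PointSeq.gal_eq_gal_iff`), which at deep levels lies in any characteristic open core
(abc-iut-L3-t6's `exists_level_gal_eq_one_ker_of_index_le`, strict coherence of `𝒢_θ`), uniformly in the
vertex; then abc-iut-L3-d4's detection engine `FreeProPRankTwo.exists_charOpenCore_conj_detection`
(p468560), whose four clauses are exactly the four branch-type configurations `(b₂, b₁)` at a vertex of the
ray, all concluding `f₂⁻¹ f₁ ∈ Π_{b₂}·V`.  Nothing of [SemiAnbd] is asserted; nothing bears on [IUTchIII]
Cor. 3.12; desk ≠ kernel for B9 itself until the two-level file lands; typed ≠ proved.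
-/

noncomputable section

namespace Literature.AnabelianGeometry.SemiGraphs

open Topology Multiplicative
open scoped Pointwise
open ProfiniteSemiGraph ProfiniteSemiGraph.GaloisLevelData
open Literature.AnabelianGeometry.SemiGraphs.FreeProPRankTwo

namespace ProfiniteSemiGraph

variable (p : ℕ) [hp : Fact p.Prime] (n : ℕ → ℕ)

/-! ### The branch homomorphisms of `𝒢_θ(p,n)` -/

/-- The upper branch `β_k⁺ = (k, true)` (abutting to `v_{k+1}`) is glued by `α`. [cite: MochizukiSemiAnbd2006, Def 2.1 p.22] -/
theorem thetaRayFreeProP_brHom_true (k v : ℕ) (h : SemiGraph.ray.abuts (k, true) = some v)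
    (t : Multiplicative ℤ_[p]) : (thetaRayFreeProP p n).brHom (k, true) v h t = α p t := rfl

/-- The lower branch `β_k⁻ = (k, false)` (abutting to `v_k`) is glued by `θ_{n_k} ∘ α`. [cite: MochizukiSemiAnbd2006, Def 2.1 p.22] -/
theorem thetaRayFreeProP_brHom_false (k v : ℕ) (h : SemiGraph.ray.abuts (k, false) = some v)
    (t : Multiplicative ℤ_[p]) : (thetaRayFreeProP p n).brHom (k, false) v h t = θ p (n k) (α p t) := rfl

/-- `β_k⁺` abuts to `v` iff `v = k + 1`. [cite: MochizukiSemiAnbd2006, §1 p.11] -/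
theorem ray_abuts_true_iff (k v : ℕ) : SemiGraph.ray.abuts (k, true) = some v ↔ v = k + 1 := by
  rw [SemiGraph.ray_abuts_true]; exact ⟨fun h => (Option.some.inj h).symm, fun h => by rw [h]⟩

/-- `β_k⁻` abuts to `v` iff `v = k`. [cite: MochizukiSemiAnbd2006, §1 p.11] -/
theorem ray_abuts_false_iff (k v : ℕ) : SemiGraph.ray.abuts (k, false) = some v ↔ v = k := by
  rw [SemiGraph.ray_abuts_false]; exact ⟨fun h => (Option.some.inj h).symm, fun h => by rw [h]⟩

/-! ### Deep levels: the stabiliser of a point of the tower lies in any characteristic open core -/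

/-- **At deep levels of the canonical tower of `𝒢_θ(p,n)`, `σ_N^h = σ_N^{h'}` forces `h⁻¹ h'` into the
characteristic open core `G(d)`**, uniformly in the vertex and the point sequence (strict coherence of
`𝒢_θ` through abc-iut-L3-t6's `exists_level_gal_eq_one_ker_of_index_le`). [cite: MochizukiSemiAnbd2006, Thm 3.7(iii) p.41] -/
theorem thetaRayFreeProP_exists_level_gal_eq_imp_mem_charOpenCore
    (h36 : (thetaRayFreeProP p n).Prop36Hypotheses) (d : ℕ) :
    ∃ N₀ : ℕ, ∀ N, N₀ ≤ N → ∀ (w : ℕ)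
      (P : ((thetaRayFreeProP p n).galoisLevelData h36).PointSeq h36.isCountable w) (h h' : Grp p),
      P.gal N h = P.gal N h' → h⁻¹ * h' ∈ charOpenCore (Grp p) d := by
  have hsc : (thetaRayFreeProP p n).IsStrictlyCoherent :=
    thetaRayFreeProP_isStrictlyCoherent p (α p) (α_ofAdd_one p) (fun m => θHom p m)
      (fun m => (θ p m).bijective) n
  haveI : (charOpenCore (Grp p) d).Normal := FreeProPRankTwo.normal_charOpenCore p d
  haveI : (charOpenCore (Grp p) d).FiniteIndex := FreeProPRankTwo.finiteIndex_charOpenCore p d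
  obtain ⟨N₀, hN₀⟩ := (thetaRayFreeProP p n).exists_level_gal_eq_one_ker_of_index_le h36 hsc
    (charOpenCore (Grp p) d).index
  refine ⟨N₀, fun N hN w P h h' heq => ?_⟩
  have hker : (QuotientGroup.mk' (charOpenCore (Grp p) d)).ker = charOpenCore (Grp p) d :=
    QuotientGroup.ker_mk' _
  have hopen : IsOpen ((QuotientGroup.mk' (charOpenCore (Grp p) d)).ker : Set (Grp p)) := by
    rw [hker]; exact FreeProPRankTwo.isOpen_charOpenCore p d
  have hne : (QuotientGroup.mk' (charOpenCore (Grp p) d)).ker.index ≠ 0 := by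
    rw [hker]; exact Subgroup.FiniteIndex.index_ne_zero
  have hle : (QuotientGroup.mk' (charOpenCore (Grp p) d)).ker.index ≤ (charOpenCore (Grp p) d).index :=
    le_of_eq (by rw [hker])
  have h1 : P.gal N (h⁻¹ * h') = 1 :=
    (P.gal_eq_one_iff N (h⁻¹ * h')).mpr ((P.gal_eq_gal_iff N h h').mp heq)
  have h2 := hN₀ N hN w P (QuotientGroup.mk' (charOpenCore (Grp p) d)) hopen hne hle (h⁻¹ * h') h1
  exact (QuotientGroup.eq_one_iff _).mp h2

/-! ### The frame shift -/

/-- **Two frames of one element at one vertex differ by the branch group, at deep levels of the canonical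
tower of `𝒢_θ(p,n)`**: for every compact `Λ ⊆ ℤ_p ∖ {0}` and every open subgroup `V ≤ F̂₂⁽ᵖ⁾` there is `N₀`
such that for all `N ≥ N₀`, vertices `w`, point sequences `P` over `w`, branches `b₁, b₂` at `w`,
`f₁, f₂ ∈ F̂₂⁽ᵖ⁾`, `k₁ ∈ ℤ_p`, `k₂ ∈ Λ`:
`σ_N^{f₁ b₁*(k₁) f₁⁻¹} = σ_N^{f₂ b₂*(k₂) f₂⁻¹} ⇒ f₂⁻¹ f₁ = b₂*(π) · v` for some `π ∈ ℤ_p`, `v ∈ V` —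
step (S1) of the typed-form audit of [SemiAnbd] Thm 3.7 (iv) clause 2 at `𝒢_θ`.
[cite: MochizukiSemiAnbd2006, Thm 3.7(iv) p.41] -/
theorem thetaRayFreeProP_frame_shift {Λ : Set (Multiplicative ℤ_[p])} (hΛ : IsCompact Λ)
    (hΛ1 : (1 : Multiplicative ℤ_[p]) ∉ Λ) (V : Subgroup (Grp p)) (hV : IsOpen (V : Set (Grp p)))
    (h36 : (thetaRayFreeProP p n).Prop36Hypotheses) :
    ∃ N₀ : ℕ, ∀ N, N₀ ≤ N → ∀ (w : ℕ)
      (P : ((thetaRayFreeProP p n).galoisLevelData h36).PointSeq h36.isCountable w)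
      (b₁ b₂ : ℕ × Bool) (hb₁ : SemiGraph.ray.abuts b₁ = some w) (hb₂ : SemiGraph.ray.abuts b₂ = some w)
      (f₁ f₂ y₁ y₂ : Grp p) (k₁ k₂ : Multiplicative ℤ_[p]), k₂ ∈ Λ →
      y₁ = (thetaRayFreeProP p n).brHom b₁ w hb₁ k₁ → y₂ = (thetaRayFreeProP p n).brHom b₂ w hb₂ k₂ →
      P.gal N (f₁ * y₁ * f₁⁻¹) = P.gal N (f₂ * y₂ * f₂⁻¹) →
      ∃ (π : Multiplicative ℤ_[p]) (y v : Grp p), y = (thetaRayFreeProP p n).brHom b₂ w hb₂ π ∧ v ∈ V ∧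
        f₂⁻¹ * f₁ = y * v := by
  obtain ⟨d, hd⟩ := FreeProPRankTwo.exists_charOpenCore_conj_detection p hΛ hΛ1 V hV
  haveI hCn : (charOpenCore (Grp p) d).Normal := FreeProPRankTwo.normal_charOpenCore p d
  obtain ⟨N₀, hN₀⟩ := thetaRayFreeProP_exists_level_gal_eq_imp_mem_charOpenCore p n h36 d
  refine ⟨N₀, fun N hN w P b₁ b₂ hb₁ hb₂ f₁ f₂ y₁ y₂ k₁ k₂ hk₂ hy₁ hy₂ heq => ?_⟩
  -- the stabiliser element lies in the core
  have hg := hN₀ N hN w P _ _ heq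
  -- generic algebra: `ε⁻¹ y₂ ε = y₁ · (f₁⁻¹ g f₁)` for `ε = f₂⁻¹ f₁`, `g = (f₁ y₁ f₁⁻¹)⁻¹ (f₂ y₂ f₂⁻¹)`
  have alg : ∀ y₁ y₂ : Grp p, (f₂⁻¹ * f₁)⁻¹ * y₂ * (f₂⁻¹ * f₁) =
      y₁ * (f₁⁻¹ * ((f₁ * y₁ * f₁⁻¹)⁻¹ * (f₂ * y₂ * f₂⁻¹)) * f₁) := fun y₁ y₂ => by group
  -- unpacking `ε ∈ S · V`
  have unpack : ∀ (S : Subgroup (Grp p)) (φ : Multiplicative ℤ_[p] →ₜ* Grp p),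
      φ.toMonoidHom.range = S → f₂⁻¹ * f₁ ∈ (S : Set (Grp p)) * (V : Set (Grp p)) →
      ∃ (π : Multiplicative ℤ_[p]) (y v : Grp p), y = φ π ∧ v ∈ V ∧ f₂⁻¹ * f₁ = y * v := by
    rintro S φ hS ⟨s, hs, v, hv, hsv⟩
    rw [← hS] at hs
    obtain ⟨π, rfl⟩ := hs
    exact ⟨π, _, v, rfl, hv, hsv.symm⟩
  -- the four branch-type configurations = the four clauses of the detection engine
  obtain ⟨j₁, _ | _⟩ := b₁ <;> obtain ⟨j₂, _ | _⟩ := b₂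
  · -- lower / lower: `w = j₁ = j₂`, clause (ii) at `t = n w`
    have hw₁ : w = j₁ := (ray_abuts_false_iff j₁ w).mp hb₁
    have hw₂ : w = j₂ := (ray_abuts_false_iff j₂ w).mp hb₂
    subst hw₁
    cases hw₂
    rw [thetaRayFreeProP_brHom_false] at hy₁ hy₂
    subst hy₁ hy₂
    have key : (f₂⁻¹ * f₁)⁻¹ * θ p (n w) (α p k₂) * (f₂⁻¹ * f₁) ∈
        (An p (n w) : Set (Grp p)) * (charOpenCore (Grp p) d : Set (Grp p)) := by
      rw [alg (θ p (n w) (α p k₁))]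
      exact ⟨θ p (n w) (α p k₁), θ_α_mem_An p (n w) k₁, _, hCn.conj_mem' _ hg f₁, rfl⟩
    exact unpack (An p (n w)) (θα p (n w)) (range_θα p (n w))
      ((hd (n w) k₂ hk₂ (f₂⁻¹ * f₁)).2.1 key)
  · -- `b₁` lower (`t = n w`), `b₂` upper: clause (iv)
    have hw₁ : w = j₁ := (ray_abuts_false_iff j₁ w).mp hb₁
    subst hw₁
    rw [thetaRayFreeProP_brHom_false] at hy₁
    rw [thetaRayFreeProP_brHom_true] at hy₂
    subst hy₁ hy₂
    have key : (f₂⁻¹ * f₁)⁻¹ * α p k₂ * (f₂⁻¹ * f₁) ∈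
        (An p (n w) : Set (Grp p)) * (charOpenCore (Grp p) d : Set (Grp p)) := by
      rw [alg (θ p (n w) (α p k₁))]
      exact ⟨θ p (n w) (α p k₁), θ_α_mem_An p (n w) k₁, _, hCn.conj_mem' _ hg f₁, rfl⟩
    exact unpack (A p) (α p) (range_α p) ((hd (n w) k₂ hk₂ (f₂⁻¹ * f₁)).2.2.2 key)
  · -- `b₁` upper, `b₂` lower (`t = n w`): clause (iii)
    have hw₂ : w = j₂ := (ray_abuts_false_iff j₂ w).mp hb₂
    subst hw₂
    rw [thetaRayFreeProP_brHom_true] at hy₁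
    rw [thetaRayFreeProP_brHom_false] at hy₂
    subst hy₁ hy₂
    have key : (f₂⁻¹ * f₁)⁻¹ * θ p (n w) (α p k₂) * (f₂⁻¹ * f₁) ∈
        (A p : Set (Grp p)) * (charOpenCore (Grp p) d : Set (Grp p)) := by
      rw [alg (α p k₁)]
      exact ⟨α p k₁, α_mem_A p k₁, _, hCn.conj_mem' _ hg f₁, rfl⟩
    exact unpack (An p (n w)) (θα p (n w)) (range_θα p (n w))
      ((hd (n w) k₂ hk₂ (f₂⁻¹ * f₁)).2.2.1 key)
  · -- upper / upper: clause (i)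
    rw [thetaRayFreeProP_brHom_true] at hy₁ hy₂
    subst hy₁ hy₂
    have key : (f₂⁻¹ * f₁)⁻¹ * α p k₂ * (f₂⁻¹ * f₁) ∈
        (A p : Set (Grp p)) * (charOpenCore (Grp p) d : Set (Grp p)) := by
      rw [alg (α p k₁)]
      exact ⟨α p k₁, α_mem_A p k₁, _, hCn.conj_mem' _ hg f₁, rfl⟩
    exact unpack (A p) (α p) (range_α p) ((hd 0 k₂ hk₂ (f₂⁻¹ * f₁)).1 key)

end ProfiniteSemiGraph

end Literature.AnabelianGeometry.SemiGraphs

end
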